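import Summits.HodgeConjecture.CorCM.IrreducibleOddWeightsShadowModulesDefect
import Summits.HodgeConjecture.CorCM.IrreducibleOddWeightsIndexParityCMFields
import Summits.HodgeConjecture.CorCM.IrreducibleOddWeightsCMTypes
import Summits.HodgeConjecture.CorCM.IrreducibleOddWeightsCertificateCovering
import Summits.HodgeConjecture.CorCM.ParallelShadowsCapacity
import HarnessLib

/-!
# Shadow modules, III (CM fields): DEFECT QUANTISATION over (IRR) pivots —
# `dim Hg(A₀) + dim Hg(A₁) − dim Hg(A₀ × A₁) ∈ {0, [T₀:ℚ]/2}` for ALL CM types, whenever the two fields contain CM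
# subfields `T₀, T₁ ⊇ traces` whose odd weights are irreducible; interaction IFF an `Aut(ℂ)`-equivariant map carries
# shadow to shadow

COR-CM (cell `pub-hodgecm2`, binder seat `b16` gen 69, count-neutral claim ROW SPACES OVER THE COMMUTANT, file Q4 — CM
fields; theorems only, no definition, no named fact, no `sorry`).  NEW as stated, hence under `Summits/`.  HONEST
FRAMING: Galois theory of CM fields inside `ℂ` and linear algebra of odd weights (files Q3/Q3b), with consequences for
`dim MT(A₀ × A₁)` of abelian varieties with complex multiplication (Kubota–Dodson rank = `dim MT`, Pohlmann); nothing is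
claimed about the algebraicity of Hodge classes; `HC_CM` is neither used nor asserted.

SETTING.  CM fields `K_{i₀} ⊇ T₀`, `K_{i₁} ⊇ T₁` with `T₀, T₁` CM SUBFIELDS CONTAINING THE TRACES (TR) (e.g. `T_κ = K_{i_κ}`);
`Anti(T) ≤ ℚ^{Hom(T,ℂ)}` the odd weights; (IRR) for `T`: `Anti(T)` has no proper non-zero `Aut(ℂ)`-stable subspace — gen 55
(`IrreducibleOddWeightsCMFields`: every (SC) field, every (M1) field; the eight (IRR)-non-(SC) octic classes).  The SHADOW
of `Φ_κ` on `Hom(T_κ, ℂ)` is odd (gen 68 P2 `shadow_conj_smul`), hence lies in `Anti(T_κ)`.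

* `finrank_antiWeights_ringHom_eq` : `dim Anti(T) = [T:ℚ]/2` for a CM field `T`.
* **`cmTypeRank_add_cmTypeRank_eq_or_of_irreducible`** — (IRR) for `T₀` and `T₁` ⟹ for EVERY pair of CM types
  `cmTypeRank Φ₀ + cmTypeRank Φ₁ = cmFamilyRank Φ + 1` (additive: `Hg(A₀ × A₁) = Hg(A₀) × Hg(A₁)`) OR
  `= cmFamilyRank Φ + 1 + [T₀:ℚ]/2`: **the defect `dim Hg(A₀)+dim Hg(A₁)−dim Hg(A₀×A₁)` is `0` or `[T₀:ℚ]/2`** — e.g.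
  `2` over quartic (IRR) pivots (the D₄ towers of gen 68), `4` over octic (IRR) pivots (the (8,8) twins and all their
  disjoint inflations in this generation's census); a non-zero defect forces `[T₀:ℚ] = [T₁:ℚ]`
  (`finrank_eq_finrank_of_cmTypeRank_add_cmTypeRank_ne`).
* **`cmTypeRank_add_cmTypeRank_ne_iff_of_irreducible`** — the pair INTERACTS iff the shadow `w₀` is non-zero and some
  `ℚ`-linear `L : ℚ^{Hom(T₁,ℂ)} → ℚ^{Hom(T₀,ℂ)}`, `Aut(ℂ)`-EQUIVARIANT and injective on `Anti(T₁)` with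
  `L(Anti(T₁)) ⊆ Anti(T₀)`, carries `w₁` to `w₀`: gen 55's criterion («no equivariant `L` with `L u₁ = u₀`», two types of
  ONE (IRR) field) for two DIFFERENT fields over (IRR) pivots, read on the shadows.  Hodge side: in the additive case every
  Hodge class on every `A₀^a × A₁^b` is a sum of exterior products (tree, via `cmFamilyRank_add_card_eq`).

## References

* [Gordon1999HodgeAVSurvey] B. B. Gordon, *A survey of the Hodge conjecture for abelian varieties*, §3 Theorem (Imai,
  Murty) with proof, 7.5–7.7, 9.4.3.
* [Kubota1965] T. Kubota, *On the field extension by complex multiplication*, Trans. AMS 118 (1965), §2 Lemma 2.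
* [Serre1977] J.-P. Serre, *Linear Representations of Finite Groups*, GTM 42, §2.2, §2.6.
* [Shimura1998] G. Shimura, *Abelian Varieties with Complex Multiplication and Modular Functions*, §8.1, §18.1.
-/

set_option autoImplicit false

noncomputable section

open scoped BigOperators Classical

open CategoryTheory CategoryTheory.Limits NumberField Module IntermediateField

namespace Summit.HodgeConjecture.CorCM

open Literature.NumberTheory.ComplexMultiplication
open Literature.AlgebraicGeometry.Motives (AbelianVariety CMType)
open Literature.AlgebraicGeometry.Motives.AbelianVariety
open Literature.AlgebraicGeometry.HodgeTheory
open Literature.AlgebraicGeometry.ComplexMultiplication (IsCMTypeRealisation)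
open Literature.AlgebraicGeometry.Pohlmann1968

/-! ### §1 The odd weights of a CM field: dimension and the shadow -/

section Anti

variable {T : Type} [Field T] [NumberField T] [IsCMField T]

/-- **`dim Anti(T) = [T:ℚ]/2`** for a CM field `T`. [cite: Kubota1965, §2 (p. 115)] [cite: Shimura1998, §18.1] -/
theorem finrank_antiWeights_ringHom_eq :
    Module.finrank ℚ (antiWeights (E := T →+* ℂ) (starRingAut : ℂ ≃+* ℂ)) = Module.finrank ℚ T / 2 := by
  obtain ⟨Ψ⟩ := nonempty_cmType_of_isCMField (K₀ := T)
  have h := isCMTypeWith_conj Ψ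
  have h1 := IrrOdd.card_le_two_mul_finrank_antiWeights (G := ℂ ≃+* ℂ) h
  have h2 := Shadow.finrank_antiWeights_le (G := ℂ ≃+* ℂ) h
  rw [NumberField.Embeddings.card T ℂ] at h1 h2
  omega

/-- `Anti(T)` is `Aut(ℂ)`-stable for a CM field `T` (complex conjugation commutes with every automorphism on the
embeddings of a CM field). [cite: Shimura1998, §18.1] [cite: Kubota1965, §2 (p. 115)] -/
theorem comp_smul_mem_antiWeights_ringHom (k : ℂ ≃+* ℂ) (a : (T →+* ℂ) → ℚ)
    (ha : a ∈ antiWeights (E := T →+* ℂ) (starRingAut : ℂ ≃+* ℂ)) :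
    (fun y => a (k • y)) ∈ antiWeights (E := T →+* ℂ) (starRingAut : ℂ ≃+* ℂ) := by
  obtain ⟨Ψ⟩ := nonempty_cmType_of_isCMField (K₀ := T)
  exact IrrOdd.comp_smul_mem_antiWeights (isCMTypeWith_conj Ψ).comm k a ha

variable {K₀ : Type} [Field K₀] [NumberField K₀] [IsCMField K₀] [Algebra T K₀]

omit [NumberField T] [IsCMField T] in
/-- **THE SHADOW IS AN ODD WEIGHT**: the shadow of a CM type of `K₀ ⊇ T` on `Hom(T, ℂ)` lies in `Anti(T)`.
[cite: Gordon1999HodgeAVSurvey, 9.4.3] [cite: Shimura1998, §18.1] -/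
theorem shadow_comp_algebraMap_mem_antiWeights (Φ₀ : CMType K₀) :
    (fun y : T →+* ℂ => ∑ t ∈ Finset.univ.filter (fun t : K₀ →+* ℂ => t.comp (algebraMap T K₀) = y),
        antiVec Φ₀.1 (1 : ℂ ≃+* ℂ) t) ∈ antiWeights (E := T →+* ℂ) (starRingAut : ℂ ≃+* ℂ) :=
  fun y => shadow_conj_smul Φ₀ y

end Anti

/-! ### §2 Defect quantisation over (IRR) pivots -/

section Quantisation

variable {I : Type} [Fintype I] {K : I → Type} [∀ i, Field (K i)] [∀ i, NumberField (K i)] [∀ i, IsCMField (K i)]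
  {T₀ : Type} [Field T₀] [NumberField T₀] [IsCMField T₀] {T₁ : Type} [Field T₁] [NumberField T₁] [IsCMField T₁]

/-- **DEFECT QUANTISATION over (IRR) pivots.**  CM subfields `T₀ ⊆ K_{i₀}`, `T₁ ⊆ K_{i₁}` containing the traces (TR) whose
odd weights `Anti(T₀)`, `Anti(T₁)` are IRREDUCIBLE `Aut(ℂ)`-modules.  Then for EVERY pair of CM types
`cmTypeRank Φ₀ + cmTypeRank Φ₁ = cmFamilyRank Φ + 1` (`Hg(A₀ × A₁) = Hg(A₀) × Hg(A₁)`) or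
`cmTypeRank Φ₀ + cmTypeRank Φ₁ = cmFamilyRank Φ + 1 + [T₀:ℚ]/2` — the defect `dim Hg(A₀)+dim Hg(A₁)−dim Hg(A₀×A₁)` takes
only the values `0` and `[T₀:ℚ]/2`. [cite: Gordon1999HodgeAVSurvey, §3 Theorem, 7.5–7.7 and 9.4.3] [cite: Serre1977, §2.6] -/
theorem cmTypeRank_add_cmTypeRank_eq_or_of_irreducible {i₀ i₁ : I} (h01 : i₀ ≠ i₁) (hI : ∀ l, l = i₀ ∨ l = i₁)
    (Φ : ∀ i, CMType (K i)) [Algebra T₀ (K i₀)] [Algebra T₁ (K i₁)]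
    (htr₀ : ∀ (a : K i₀ →+* ℂ) (k : K i₀), a k ∈ normalClosure ℚ (K i₁) ℂ → k ∈ Set.range (algebraMap T₀ (K i₀)))
    (htr₁ : ∀ (b : K i₁ →+* ℂ) (k : K i₁), b k ∈ normalClosure ℚ (K i₀) ℂ → k ∈ Set.range (algebraMap T₁ (K i₁)))
    (hirr₀ : ∀ W : Submodule ℚ ((T₀ →+* ℂ) → ℚ), W ≤ antiWeights (E := T₀ →+* ℂ) (starRingAut : ℂ ≃+* ℂ) → W ≠ ⊥ →
      (∀ (k : ℂ ≃+* ℂ) (f : (T₀ →+* ℂ) → ℚ), f ∈ W → (fun y => f (k • y)) ∈ W) →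
        W = antiWeights (E := T₀ →+* ℂ) (starRingAut : ℂ ≃+* ℂ))
    (hirr₁ : ∀ W : Submodule ℚ ((T₁ →+* ℂ) → ℚ), W ≤ antiWeights (E := T₁ →+* ℂ) (starRingAut : ℂ ≃+* ℂ) → W ≠ ⊥ →
      (∀ (k : ℂ ≃+* ℂ) (f : (T₁ →+* ℂ) → ℚ), f ∈ W → (fun y => f (k • y)) ∈ W) →
        W = antiWeights (E := T₁ →+* ℂ) (starRingAut : ℂ ≃+* ℂ)) :
    cmTypeRank (Φ i₀) + cmTypeRank (Φ i₁) = CMAlgebra.cmFamilyRank Φ + 1 ∨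
      cmTypeRank (Φ i₀) + cmTypeRank (Φ i₁) = CMAlgebra.cmFamilyRank Φ + 1 + Module.finrank ℚ T₀ / 2 := by
  haveI : ∀ i, Nonempty (K i →+* ℂ) := fun i => inferInstance
  rw [← finrank_antiWeights_ringHom_eq (T := T₀)]
  exact IrrOdd.typeRank_add_typeRank_eq_or_eq_add_finrank_of_irreducible (G := ℂ ≃+* ℂ)
    (E := fun i => K i →+* ℂ) (Φ := fun i => (Φ i).1) (fun i => isCMTypeWith_conj (Φ i)) hI h01
    (fun t : K i₀ →+* ℂ => t.comp (algebraMap T₀ (K i₀))) (fun t : K i₁ →+* ℂ => t.comp (algebraMap T₁ (K i₁)))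
    (fun _ _ => rfl) (fun _ _ => rfl) (exists_stab_smul_eq_of_comp_eq_of_trace_le i₁ htr₀)
    (exists_stab_smul_eq_of_comp_eq_of_trace_le i₀ htr₁)
    comp_smul_mem_antiWeights_ringHom hirr₀ comp_smul_mem_antiWeights_ringHom hirr₁
    (shadow_comp_algebraMap_mem_antiWeights (Φ i₀)) (shadow_comp_algebraMap_mem_antiWeights (Φ i₁))

/-- **INTERACTION CRITERION over (IRR) pivots**: under the same hypotheses the pair INTERACTS
(`cmTypeRank Φ₀ + cmTypeRank Φ₁ ≠ cmFamilyRank Φ + 1`, i.e. `dim Hg(A₀ × A₁) < dim Hg(A₀) + dim Hg(A₁)`) IFF the shadow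
`w₀` of `Φ₀` on `Hom(T₀, ℂ)` is non-zero and an `Aut(ℂ)`-EQUIVARIANT `ℚ`-linear map `L : ℚ^{Hom(T₁,ℂ)} → ℚ^{Hom(T₀,ℂ)}`,
injective on `Anti(T₁)` with `L(Anti(T₁)) ⊆ Anti(T₀)`, carries the shadow `w₁` of `Φ₁` to `w₀`.
[cite: Gordon1999HodgeAVSurvey, §3 Theorem, 7.5–7.7 and 9.4.3] [cite: Serre1977, §2.2] -/
theorem cmTypeRank_add_cmTypeRank_ne_iff_of_irreducible {i₀ i₁ : I} (h01 : i₀ ≠ i₁) (hI : ∀ l, l = i₀ ∨ l = i₁)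
    (Φ : ∀ i, CMType (K i)) [Algebra T₀ (K i₀)] [Algebra T₁ (K i₁)]
    (htr₀ : ∀ (a : K i₀ →+* ℂ) (k : K i₀), a k ∈ normalClosure ℚ (K i₁) ℂ → k ∈ Set.range (algebraMap T₀ (K i₀)))
    (htr₁ : ∀ (b : K i₁ →+* ℂ) (k : K i₁), b k ∈ normalClosure ℚ (K i₀) ℂ → k ∈ Set.range (algebraMap T₁ (K i₁)))
    (hirr₀ : ∀ W : Submodule ℚ ((T₀ →+* ℂ) → ℚ), W ≤ antiWeights (E := T₀ →+* ℂ) (starRingAut : ℂ ≃+* ℂ) → W ≠ ⊥ →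
      (∀ (k : ℂ ≃+* ℂ) (f : (T₀ →+* ℂ) → ℚ), f ∈ W → (fun y => f (k • y)) ∈ W) →
        W = antiWeights (E := T₀ →+* ℂ) (starRingAut : ℂ ≃+* ℂ))
    (hirr₁ : ∀ W : Submodule ℚ ((T₁ →+* ℂ) → ℚ), W ≤ antiWeights (E := T₁ →+* ℂ) (starRingAut : ℂ ≃+* ℂ) → W ≠ ⊥ →
      (∀ (k : ℂ ≃+* ℂ) (f : (T₁ →+* ℂ) → ℚ), f ∈ W → (fun y => f (k • y)) ∈ W) →
        W = antiWeights (E := T₁ →+* ℂ) (starRingAut : ℂ ≃+* ℂ)) :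
    cmTypeRank (Φ i₀) + cmTypeRank (Φ i₁) ≠ CMAlgebra.cmFamilyRank Φ + 1 ↔
      (fun y : T₀ →+* ℂ => ∑ t ∈ Finset.univ.filter (fun t : K i₀ →+* ℂ => t.comp (algebraMap T₀ (K i₀)) = y),
          antiVec (Φ i₀).1 (1 : ℂ ≃+* ℂ) t) ≠ 0 ∧
        ∃ L : ((T₁ →+* ℂ) → ℚ) →ₗ[ℚ] ((T₀ →+* ℂ) → ℚ),
          (∀ f ∈ antiWeights (E := T₁ →+* ℂ) (starRingAut : ℂ ≃+* ℂ),
              L f ∈ antiWeights (E := T₀ →+* ℂ) (starRingAut : ℂ ≃+* ℂ)) ∧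
            (∀ f ∈ antiWeights (E := T₁ →+* ℂ) (starRingAut : ℂ ≃+* ℂ), L f = 0 → f = 0) ∧
            (∀ (k : ℂ ≃+* ℂ) (f : (T₁ →+* ℂ) → ℚ), f ∈ antiWeights (E := T₁ →+* ℂ) (starRingAut : ℂ ≃+* ℂ) →
              L (fun y => f (k • y)) = fun y => L f (k • y)) ∧
            L (fun y : T₁ →+* ℂ => ∑ t ∈ Finset.univ.filter (fun t : K i₁ →+* ℂ => t.comp (algebraMap T₁ (K i₁)) = y),
                antiVec (Φ i₁).1 (1 : ℂ ≃+* ℂ) t) =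
              fun y : T₀ →+* ℂ => ∑ t ∈ Finset.univ.filter (fun t : K i₀ →+* ℂ => t.comp (algebraMap T₀ (K i₀)) = y),
                antiVec (Φ i₀).1 (1 : ℂ ≃+* ℂ) t := by
  haveI : ∀ i, Nonempty (K i →+* ℂ) := fun i => inferInstance
  exact IrrOdd.typeRank_add_typeRank_ne_iff_of_irreducible (G := ℂ ≃+* ℂ)
    (E := fun i => K i →+* ℂ) (Φ := fun i => (Φ i).1) (fun i => isCMTypeWith_conj (Φ i)) hI h01
    (fun t : K i₀ →+* ℂ => t.comp (algebraMap T₀ (K i₀))) (fun t : K i₁ →+* ℂ => t.comp (algebraMap T₁ (K i₁)))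
    (fun _ _ => rfl) (fun _ _ => rfl) (exists_stab_smul_eq_of_comp_eq_of_trace_le i₁ htr₀)
    (exists_stab_smul_eq_of_comp_eq_of_trace_le i₀ htr₁)
    comp_smul_mem_antiWeights_ringHom hirr₀ comp_smul_mem_antiWeights_ringHom hirr₁
    (shadow_comp_algebraMap_mem_antiWeights (Φ i₀)) (shadow_comp_algebraMap_mem_antiWeights (Φ i₁))

/-- **A NON-ZERO DEFECT FORCES `[T₀:ℚ] = [T₁:ℚ]`** (the equivariant `L` is an isomorphism `Anti(T₁) ≅ Anti(T₀)`).
[cite: Gordon1999HodgeAVSurvey, §3 Theorem, 7.5–7.7] [cite: Serre1977, §2.2] -/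
theorem finrank_eq_finrank_of_cmTypeRank_add_cmTypeRank_ne {i₀ i₁ : I} (h01 : i₀ ≠ i₁) (hI : ∀ l, l = i₀ ∨ l = i₁)
    (Φ : ∀ i, CMType (K i)) [Algebra T₀ (K i₀)] [Algebra T₁ (K i₁)]
    (htr₀ : ∀ (a : K i₀ →+* ℂ) (k : K i₀), a k ∈ normalClosure ℚ (K i₁) ℂ → k ∈ Set.range (algebraMap T₀ (K i₀)))
    (htr₁ : ∀ (b : K i₁ →+* ℂ) (k : K i₁), b k ∈ normalClosure ℚ (K i₀) ℂ → k ∈ Set.range (algebraMap T₁ (K i₁)))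
    (hirr₀ : ∀ W : Submodule ℚ ((T₀ →+* ℂ) → ℚ), W ≤ antiWeights (E := T₀ →+* ℂ) (starRingAut : ℂ ≃+* ℂ) → W ≠ ⊥ →
      (∀ (k : ℂ ≃+* ℂ) (f : (T₀ →+* ℂ) → ℚ), f ∈ W → (fun y => f (k • y)) ∈ W) →
        W = antiWeights (E := T₀ →+* ℂ) (starRingAut : ℂ ≃+* ℂ))
    (hirr₁ : ∀ W : Submodule ℚ ((T₁ →+* ℂ) → ℚ), W ≤ antiWeights (E := T₁ →+* ℂ) (starRingAut : ℂ ≃+* ℂ) → W ≠ ⊥ →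
      (∀ (k : ℂ ≃+* ℂ) (f : (T₁ →+* ℂ) → ℚ), f ∈ W → (fun y => f (k • y)) ∈ W) →
        W = antiWeights (E := T₁ →+* ℂ) (starRingAut : ℂ ≃+* ℂ))
    (hne : cmTypeRank (Φ i₀) + cmTypeRank (Φ i₁) ≠ CMAlgebra.cmFamilyRank Φ + 1) :
    Module.finrank ℚ T₀ = Module.finrank ℚ T₁ := by
  haveI : ∀ i, Nonempty (K i →+* ℂ) := fun i => inferInstance
  have hpair := cmTypeRank_add_cmTypeRank_eq_cmFamilyRank_add_one_add_finrank_shadow_inf_shadow h01 hI Φ htr₀ htr₁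
  have hbot : Submodule.span ℚ (Set.range fun y : T₀ →+* ℂ => fun g : ℂ ≃+* ℂ =>
        ∑ t ∈ Finset.univ.filter (fun t : K i₀ →+* ℂ => t.comp (algebraMap T₀ (K i₀)) = g • y),
          antiVec (Φ i₀).1 (1 : ℂ ≃+* ℂ) t) ⊓
      Submodule.span ℚ (Set.range fun y : T₁ →+* ℂ => fun g : ℂ ≃+* ℂ =>
        ∑ t ∈ Finset.univ.filter (fun t : K i₁ →+* ℂ => t.comp (algebraMap T₁ (K i₁)) = g • y),
          antiVec (Φ i₁).1 (1 : ℂ ≃+* ℂ) t) ≠ ⊥ := by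
    intro h
    rw [h, finrank_bot, add_zero] at hpair
    exact hne hpair
  have key := IrrOdd.finrank_eq_finrank_of_span_shadowCoeff_inf_ne_bot (G := ℂ ≃+* ℂ)
    (comp_smul_mem_antiWeights_ringHom (T := T₀)) hirr₀ (comp_smul_mem_antiWeights_ringHom (T := T₁)) hirr₁
    (shadow_comp_algebraMap_mem_antiWeights (T := T₀) (Φ i₀)) (shadow_comp_algebraMap_mem_antiWeights (T := T₁) (Φ i₁)) hbot
  rw [finrank_antiWeights_ringHom_eq, finrank_antiWeights_ringHom_eq] at key
  -- `[T:ℚ]` is even for a CM field: `2 (n/2) = n`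
  have h0 := IrrOdd.card_le_two_mul_finrank_antiWeights (G := ℂ ≃+* ℂ)
    (isCMTypeWith_conj (Classical.choice (nonempty_cmType_of_isCMField (K₀ := T₀))))
  have h1 := IrrOdd.card_le_two_mul_finrank_antiWeights (G := ℂ ≃+* ℂ)
    (isCMTypeWith_conj (Classical.choice (nonempty_cmType_of_isCMField (K₀ := T₁))))
  rw [NumberField.Embeddings.card, finrank_antiWeights_ringHom_eq] at h0 h1
  omega

end Quantisation

end Summit.HodgeConjecture.CorCM

end
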